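import Summits.Parity.GeneralizedHardyLittlewood.Theorems.ChenParityOracleBLAPParityOracleChenTools
import HarnessLib

/-!
# Route `ChenParityOracleBLAP` — crux `ParityOracleChen` (stmt-Parity-20046): estimate (A′)

Support file 2/5: the LOWER bound for the parity subset `𝒜′(x) = {p + 2 : 2 < p ≤ x, λ(p+2) = −1}` of
Chen's twin sequence, `S(𝒜′(x), x^{1/8}) ≥ (e^γ log 3/4 − ε)(x/log x)V(x^{1/8})` for large `x`, under the
oracle hypothesis `∑_{d ≤ x^{1/2−ε}} |∑_{n ∈ 𝒜(x), d∣n} λ(n)| = o(x/(log x)²)` (the route's HP1). This is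
the tree's PROVED estimate (A) `Literature.NumberTheory.Sieve.Chen.twin_sieveLower_holds`
(Nathanson Thm 10.4 for `{p + 2}`; Iwaniec's linear sieve + Bombieri–Vinogradov + PNT + Mertens) with
the main term halved: the proof is the tree's, with Iwaniec's Theorem 1 replaced by its twisted form
`Iwaniec1980_twisted_lower_of_half_lt` (`e(n) = 1_𝒜(n)λ(n)`), whose extra oracle remainder is the
hypothesis.

References: [Nathanson1996] Thm 10.4; [ChenSciSinica1973] p. 176; [IwaniecActaArith1980] Thm 1.
-/

namespace Summit.Parity.GeneralizedHardyLittlewood.Theorems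

open Finset Filter Topology
open scoped ArithmeticFunction.Moebius ArithmeticFunction.Omega
open Literature.NumberTheory.Sieve Literature.NumberTheory.Sieve.Chen
  Literature.NumberTheory.Sieve.ChenSieve Literature.NumberTheory.Sieve.SieveSequence

/-- The oracle weights of the twin sequence are dominated by its weights: `1_𝒜(n) λ(n) ≤ 1_𝒜(n)`. -/
theorem twinWeight_mul_liouville_le (x n : ℕ) :
    twinWeight x n * (ArithmeticFunction.liouville n : ℝ) ≤ (twinSeq x).a n := by
  change twinWeight x n * (ArithmeticFunction.liouville n : ℝ) ≤ twinWeight x n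
  have h1 := abs_liouville_le_one n
  have h0 := twinWeight_nonneg x n
  have : twinWeight x n * (ArithmeticFunction.liouville n : ℝ) ≤ twinWeight x n * 1 :=
    mul_le_mul_of_nonneg_left (le_of_abs_le h1) h0
  linarith

/-- The twisted sifted sum of the twin sequence at height `x + 2` is the rough count of the parity
subset `𝒜′(x) = {n ∈ 𝒜(x) : λ(n) = −1}`. -/
theorem twistedSifted_twinSeq_eq (x : ℕ) (w : ℝ) :
    ∑ n ∈ (Finset.Ioc 0 ⌊((x + 2 : ℕ) : ℝ)⌋₊).filter (fun n : ℕ => n.Coprime (primesProdBelow w)),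
        ((twinSeq x).a n - twinWeight x n * (ArithmeticFunction.liouville n : ℝ)) / 2 =
      (roughCount ((twinSieveSet x).filter fun n => ArithmeticFunction.liouville n = -1) ⌈w⌉₊ : ℝ) := by
  have h := twistedSifted_indicator_eq (twinSieveSet x) (twinSieveSet_subset_Ioc x) w
  refine Eq.trans (Finset.sum_congr rfl fun n _ => ?_) h
  rfl

/-- The oracle remainder of the twin sequence: `E_d(x + 2) = Λ_d(x) = ∑_{n ∈ 𝒜(x), d ∣ n} λ(n)`. -/
theorem twistedCongrSum_twinSeq_eq (x d : ℕ) :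
    ∑ n ∈ (Finset.Ioc 0 ⌊((x + 2 : ℕ) : ℝ)⌋₊).filter (d ∣ ·),
        twinWeight x n * (ArithmeticFunction.liouville n : ℝ) =
      ∑ n ∈ (twinSieveSet x).filter (fun n => d ∣ n), (ArithmeticFunction.liouville n : ℝ) := by
  have h := twistedCongrSum_indicator_eq (twinSieveSet x) (twinSieveSet_subset_Ioc x) d
  refine Eq.trans (Finset.sum_congr rfl fun n _ => ?_) h
  rfl

set_option maxHeartbeats 800000 in
/-- **(A′) The lower bound for the parity subset of Chen's twin sequence, under the oracle
hypothesis.** Suppose that for every `ε, η > 0` and all large `x`,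
`∑_{d ≤ x^{1/2−ε}} |∑_{n ∈ 𝒜(x), d ∣ n} λ(n)| ≤ η x/(log x)²` (`𝒜(x) = {p + 2 : 2 < p ≤ x}`; the route's
hypothesis HP1 up to the prime `p = 2`). Then for every `ε > 0` and all large `x`,
`S(𝒜′(x), x^{1/8}) ≥ (e^γ log 3/4 − ε)(x/log x) V(x^{1/8})`, `𝒜′(x) = {n ∈ 𝒜(x) : λ(n) = −1}` — Nathanson's
Theorem 10.4 for the sequence `{p + 2}` (the tree's `Chen.twin_sieveLower_holds`) with the main term
HALVED. Proof: the tree's proof verbatim (Iwaniec's linear sieve, `f(s) = 2e^γ log(s−1)/s` at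
`s = 4 − 8δ`, Bombieri–Vinogradov for the remainder of `𝒜`, PNT for `|𝒜| = π(x) − 1`, `V ≫ 1/log x`),
with Iwaniec's Theorem 1 replaced by its twisted form `Iwaniec1980_twisted_lower_of_half_lt`
(`e(n) = 1_𝒜(n)λ(n)`): the oracle remainder `½ ∑_{d < x^{1/2−δ}} |Λ_d(x)|` is `≤ ε/4 · X V` by hypothesis. -/
theorem parity_twin_sieveLower
    (hΛ : ∀ ε : ℝ, 0 < ε → ∀ η : ℝ, 0 < η → ∀ᶠ x : ℕ in atTop,
      (∑ d ∈ Finset.Icc 1 ⌊(x : ℝ) ^ (1 / 2 - ε)⌋₊,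
        |∑ n ∈ (twinSieveSet x).filter (fun n => d ∣ n), (ArithmeticFunction.liouville n : ℝ)|) ≤
          η * (x : ℝ) / Real.log x ^ 2) :
    ∀ ε : ℝ, 0 < ε → ∀ᶠ x : ℕ in atTop,
      (Real.exp Real.eulerMascheroniConstant * Real.log 3 / 4 - ε) * twinMainTerm x ≤
        (roughCount ((twinSieveSet x).filter fun n => ArithmeticFunction.liouville n = -1)
          (twinZ x) : ℝ) := by
  intro ε hε
  set G := Real.exp Real.eulerMascheroniConstant with hG
  have hG1 : 1 ≤ G := Real.one_le_exp (by linarith [Real.one_half_lt_eulerMascheroniConstant])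
  have hlog3 : 1 < Real.log 3 := by
    rw [Real.lt_log_iff_exp_lt (by norm_num)]
    exact Real.exp_one_lt_d9.trans (by norm_num)
  set a := G * Real.log 3 / 2 with ha
  have ha0 : 0 < a := by positivity
  have haq : G * Real.log 3 / 4 = a / 2 := by rw [ha]; ring
  rw [haq]
  -- trivial case `ε ≥ a/2`
  rcases le_or_gt (a / 2) ε with hεa | hεa
  · refine Eventually.of_forall fun x => ?_
    have h1 : (a / 2 - ε) * twinMainTerm x ≤ 0 :=
      mul_nonpos_of_nonpos_of_nonneg (by linarith) (twinMainTerm_nonneg x)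
    exact h1.trans (Nat.cast_nonneg _)
  -- parameters
  set δ := min (1 / 16) (ε / (16 * G)) with hδ
  have hδ0 : 0 < δ := by positivity
  have hδ1 : δ ≤ 1 / 16 := min_le_left _ _
  have hδ2 : δ ≤ ε / (16 * G) := min_le_right _ _
  set η := ε / (16 * a) with hη
  have hη0 : 0 < η := by positivity
  set θ₁ := 1 / 2 - δ with hθ₁
  have hθ₁lt : θ₁ < 1 / 2 := by rw [hθ₁]; linarith
  have hθ₁0 : 0 < θ₁ := by rw [hθ₁]; linarith
  set L₀ := 54 * Real.exp (54 / Real.log 2) with hL₀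
  -- Iwaniec's Theorem 1 for `κ = 1`, twisted form
  obtain ⟨B, hB, hBC⟩ := Iwaniec1980_twisted_lower_of_half_lt (κ := 1) (by norm_num)
  obtain ⟨C₁, hC₁⟩ := hBC L₀
  -- Bombieri–Vinogradov
  obtain ⟨C, hC⟩ := eventually_sum_abs_primeCountingDisc_le BombieriVinogradovStatement_holds hθ₁lt
    (A := 4) (by norm_num)
  set c₀ := 16 * Real.exp (-7) with hc₀
  have hc₀0 : 0 < c₀ := by positivity
  -- the oracle hypothesis at level `x^{1/2 - δ}` with `η' = ε c₀ / 4`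
  have hO := hΛ δ hδ0 (ε * c₀ / 4) (by positivity)
  -- eventualities
  have hE1 := eventually_primeCounting_bounds hη0
  have hE4 : ∀ᶠ x : ℕ in atTop, a ≤ ε / 6 * c₀ * x / Real.log x ^ 2 :=
    (tendsto_mul_natCast_div_log_sq_atTop (by positivity : 0 < ε / 6 * c₀)).eventually_ge_atTop a
  have hE5 : ∀ᶠ x : ℕ in atTop, 6 * max C 0 / (ε * c₀) + 1 ≤ Real.log x :=
    (Real.tendsto_log_atTop.comp tendsto_natCast_atTop_atTop).eventually_ge_atTop _
  have hE6 : ∀ᶠ x : ℕ in atTop, Real.log (x : ℝ) ^ 2 ≤ ε * c₀ / 6 * (x : ℝ) ^ (1 - θ₁) := by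
    have hlo := (isLittleO_log_rpow_rpow_atTop 2 (show (0 : ℝ) < 1 - θ₁ by rw [hθ₁]; linarith)).def
      (show 0 < ε * c₀ / 6 by positivity)
    filter_upwards [tendsto_natCast_atTop_atTop.eventually hlo, eventually_ge_atTop 1] with x hx hx1
    have hx0 : (0 : ℝ) ≤ x := Nat.cast_nonneg x
    rw [Real.norm_of_nonneg (by positivity), Real.norm_of_nonneg (Real.rpow_nonneg hx0 _)] at hx
    have : Real.log (x : ℝ) ^ (2 : ℝ) = Real.log x ^ 2 := by
      rw [show (2 : ℝ) = ((2 : ℕ) : ℝ) by norm_num, Real.rpow_natCast]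
    rwa [this] at hx
  -- Iwaniec's error term `C₁ (log y)^{-1/3} → 0`
  have hT : Tendsto (fun x : ℕ => max C₁ 0 * (θ₁ * Real.log (x : ℝ)) ^ (-(1 / 3 : ℝ))) atTop
      (𝓝 (max C₁ 0 * 0)) :=
    ((tendsto_rpow_neg_atTop (by norm_num : (0 : ℝ) < 1 / 3)).comp
      ((Real.tendsto_log_atTop.comp tendsto_natCast_atTop_atTop).const_mul_atTop hθ₁0)).const_mul _
  rw [mul_zero] at hT
  have hE7 : ∀ᶠ x : ℕ in atTop, max C₁ 0 * (θ₁ * Real.log (x : ℝ)) ^ (-(1 / 3 : ℝ)) ≤ ε / 16 :=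
    hT.eventually (ge_mem_nhds (by positivity : (0 : ℝ) < ε / 16))
  filter_upwards [eventually_ge_atTop 6561, hE1, hC, hE4, hE5, hE6, hE7, hO]
    with x hx hPNT hBVx hj1 hj5 hj6 hj7 hOx
  -- basic facts about `x`
  have hx2 : 2 ≤ x := by omega
  have hx1 : (1 : ℝ) < x := by exact_mod_cast (show 1 < x by omega)
  have hx0 : (0 : ℝ) < x := by linarith
  have hlog : 0 < Real.log x := Real.log_pos hx1
  have hlog1 : 1 ≤ Real.log x := by
    have : 0 ≤ 6 * max C 0 / (ε * c₀) := by positivity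
    linarith
  -- the sieve parameters
  set z := (x : ℝ) ^ (1 / 8 : ℝ) with hz
  set y := (x : ℝ) ^ θ₁ with hy
  have hz2 : 2 ≤ z := by
    rw [hz, show (2 : ℝ) = ((2 : ℝ) ^ (8 : ℕ)) ^ (1 / 8 : ℝ) by
      rw [← Real.rpow_natCast, ← Real.rpow_mul (by norm_num)]; norm_num]
    exact Real.rpow_le_rpow (by norm_num) (by exact_mod_cast (show 256 ≤ x by omega)) (by norm_num)
  have hlogz : Real.log z = 1 / 8 * Real.log x := by rw [hz, Real.log_rpow hx0]
  have hlogy : Real.log y = θ₁ * Real.log x := by rw [hy, Real.log_rpow hx0]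
  have hs : Real.log y / Real.log z = 4 - 8 * δ := by
    rw [hlogz, hlogy, hθ₁]; field_simp; ring
  have hzy : z ≤ y := by
    rw [hz, hy]
    exact Real.rpow_le_rpow_of_exponent_le hx1.le (by rw [hθ₁]; linarith)
  have hy0 : 0 ≤ y := Real.rpow_nonneg hx0.le _
  -- names for the quantities
  set V := sieveProduct 2 z with hV
  set P := (Nat.primeCounting x : ℝ) - 1 with hP
  set L := (x : ℝ) / Real.log x with hL
  set R := ∑ d ∈ (Finset.range ⌈y⌉₊).filter (· ∣ primesProdBelow z),
    |(twinSeq x).remainder d ((x + 2 : ℕ) : ℝ)| with hR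
  set RE := ∑ d ∈ (Finset.range ⌈y⌉₊).filter (· ∣ primesProdBelow z),
    |∑ n ∈ (Finset.Ioc 0 ⌊((x + 2 : ℕ) : ℝ)⌋₊).filter (d ∣ ·),
      twinWeight x n * (ArithmeticFunction.liouville n : ℝ)| with hRE
  set K := c₀ * x / Real.log x ^ 2 with hK
  have hVI : 0 ≤ V ∧ V ≤ 1 := sieveProduct_two_mem_Icc z
  have hP0 : 0 ≤ P := by
    have : 1 ≤ Nat.primeCounting x := by
      have := Nat.primesLE_card_eq_primeCounting x
      have h2 : 2 ∈ Nat.primesLE x := Nat.mem_primesLE.mpr ⟨hx2, Nat.prime_two⟩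
      have := Finset.card_pos.mpr ⟨2, h2⟩
      omega
    rw [hP]
    have : (1 : ℝ) ≤ Nat.primeCounting x := by exact_mod_cast this
    linarith
  have hL0 : 0 ≤ L := by positivity
  have hmainTerm : twinMainTerm x = L * V := by rw [twinMainTerm, hL, hV, hz]
  have hKM : K ≤ L * V := by
    rw [← hmainTerm, hK, hc₀]
    exact twinMainTerm_ge hx
  -- Iwaniec's theorem (twisted) applied to the twin sequence at height `x + 2`
  have hsz : (twinSeq x).size ((x + 2 : ℕ) : ℝ) = P := rfl
  have hI := hC₁ (twinSeq x) (hasIwaniecDimension_twinSeq x)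
    (fun n => twinWeight x n * (ArithmeticFunction.liouville n : ℝ)) (twinWeight_mul_liouville_le x)
    ((x + 2 : ℕ) : ℝ) y z hz2 hzy (by rw [hsz]; exact hP0)
  rw [hsz, densityProduct_twinSeq_primesProdBelow, twistedSifted_twinSeq_eq, hs,
    greatestBetaSieveData_one_lower_eq hB (by linarith) (by linarith), ← hG, ← hV, ← hR, ← hRE] at hI
  change _ ≤ (roughCount ((twinSieveSet x).filter fun n => ArithmeticFunction.liouville n = -1)
    (twinZ x) : ℝ) at hI
  -- (1) the coefficient: `f(s) - C₁ (log y)^{-1/3} ≥ a - ε/4`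
  have hcoef := sieveLowerConst_ge hε hδ0 hδ1 hδ2 (εJ := 0) (by positivity)
  rw [← hG, ← ha, zero_mul, sub_zero] at hcoef
  have herrI : C₁ * Real.log y ^ (-(1 / 3 : ℝ)) ≤ ε / 16 := by
    rw [hlogy]
    have h0 : 0 ≤ (θ₁ * Real.log x) ^ (-(1 / 3 : ℝ)) := Real.rpow_nonneg (by positivity) _
    exact (mul_le_mul_of_nonneg_right (le_max_left C₁ 0) h0).trans hj7
  have hfE : a - ε / 4 ≤ 2 * G * Real.log (4 - 8 * δ - 1) / (4 - 8 * δ) - C₁ * Real.log y ^ (-(1 / 3 : ℝ)) := by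
    linarith
  -- (2) the main term: `(a - ε/4) V P ≥ (a - 5ε/16) L V - a`
  have hPNT' : (1 - η) * L - 1 ≤ P := by rw [hP]; linarith [hPNT.1]
  have ha' : 0 ≤ a - ε / 4 := by linarith
  have hmain : (a - 5 * ε / 16) * (L * V) - a ≤ (a - ε / 4) * (V * P) := by
    have h1 : (a - ε / 4) * (V * ((1 - η) * L - 1)) ≤ (a - ε / 4) * (V * P) :=
      mul_le_mul_of_nonneg_left (mul_le_mul_of_nonneg_left hPNT' hVI.1) ha'
    have h2 : (a - ε / 4) * V ≤ a := by
      have h21 : (a - ε / 4) * V ≤ a * V := mul_le_mul_of_nonneg_right (by linarith) hVI.1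
      have h22 : a * V ≤ a * 1 := mul_le_mul_of_nonneg_left hVI.2 ha0.le
      linarith
    have h3 : a * η = ε / 16 := by rw [hη]; field_simp
    have h4 : (a - ε / 4) * η * (L * V) ≤ ε / 16 * (L * V) := by
      refine mul_le_mul_of_nonneg_right ?_ (mul_nonneg hL0 hVI.1)
      have : (a - ε / 4) * η = ε / 16 - ε * η / 4 := by rw [← h3]; ring
      have : 0 ≤ ε * η := mul_nonneg hε.le hη0.le
      linarith
    have hLV : 0 ≤ L * V := mul_nonneg hL0 hVI.1
    linarith
  -- (3) the remainder of the twin sequence (Bombieri–Vinogradov)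
  have hRle : R ≤ C * x / Real.log x ^ 4 + y := by
    rw [hR]
    refine (iwaniecRemainderSum_twinSeq_le hx2 z le_rfl hy0).trans ?_
    have h2 := hBVx negTwoUnit
    rw [show (4 : ℝ) = ((4 : ℕ) : ℝ) by norm_num, Real.rpow_natCast] at h2
    exact add_le_add h2 le_rfl
  have hj5' : max C 0 * x / Real.log x ^ 4 ≤ ε / 6 * K := by
    have hM0 : 0 ≤ max C 0 := le_max_right _ _
    have hlog2 : 6 * max C 0 / (ε * c₀) ≤ Real.log x ^ 2 := by
      have h1 : 6 * max C 0 / (ε * c₀) ≤ Real.log x := by linarith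
      have h2 : Real.log x ≤ Real.log x ^ 2 := by nlinarith
      exact h1.trans h2
    have hlog3 : 6 * max C 0 ≤ ε * c₀ * Real.log x ^ 2 := by
      rw [div_le_iff₀ (by positivity)] at hlog2
      linarith
    rw [hK, show max C 0 * (x : ℝ) / Real.log x ^ 4 =
        (max C 0 / Real.log x ^ 2) * (x / Real.log x ^ 2) by
          rw [div_mul_div_comm, show Real.log (x : ℝ) ^ 2 * Real.log x ^ 2 = Real.log x ^ 4 by ring],
      show ε / 6 * (c₀ * x / Real.log x ^ 2) = (ε * c₀ / 6) * (x / Real.log x ^ 2) by ring]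
    refine mul_le_mul_of_nonneg_right ?_ (by positivity)
    rw [div_le_iff₀ (by positivity)]
    linarith
  have hj6' : y ≤ ε / 6 * K := by
    have hsplit : (x : ℝ) = (x : ℝ) ^ θ₁ * (x : ℝ) ^ (1 - θ₁) := by
      rw [← Real.rpow_add hx0]; norm_num
    rw [hy, hK, show ε / 6 * (c₀ * x / Real.log x ^ 2) = (ε * c₀ / 6 * x) / Real.log x ^ 2 by ring,
      le_div_iff₀ (by positivity)]
    calc (x : ℝ) ^ θ₁ * Real.log x ^ 2 ≤ (x : ℝ) ^ θ₁ * (ε * c₀ / 6 * (x : ℝ) ^ (1 - θ₁)) :=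
          mul_le_mul_of_nonneg_left hj6 (Real.rpow_nonneg hx0.le _)
      _ = ε * c₀ / 6 * ((x : ℝ) ^ θ₁ * (x : ℝ) ^ (1 - θ₁)) := by ring
      _ = ε * c₀ / 6 * x := by rw [← hsplit]
  have hCle : C * x / Real.log x ^ 4 ≤ max C 0 * x / Real.log x ^ 4 := by
    have : 0 ≤ (x : ℝ) / Real.log x ^ 4 := by positivity
    rw [mul_div_assoc, mul_div_assoc]
    exact mul_le_mul_of_nonneg_right (le_max_left _ _) this
  have hj1' : a ≤ ε / 6 * K := by
    rw [hK, show ε / 6 * (c₀ * x / Real.log x ^ 2) = ε / 6 * c₀ * x / Real.log x ^ 2 by ring]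
    exact hj1
  -- (4) the oracle remainder: `RE ≤ ∑_{d ≤ x^{1/2-δ}} |Λ_d| ≤ (ε c₀/4) x/(log x)² = ε/4 · K`
  have hREle : RE ≤ ε / 4 * K := by
    have h1 : RE ≤ ∑ d ∈ Finset.Icc 1 ⌊y⌋₊,
        |∑ n ∈ (twinSieveSet x).filter (fun n => d ∣ n), (ArithmeticFunction.liouville n : ℝ)| := by
      rw [hRE]
      refine le_trans (Finset.sum_le_sum fun d _ => ?_)
        (sum_range_filter_dvd_le_sum_Icc (fun d => abs_nonneg _) z)
      rw [twistedCongrSum_twinSeq_eq]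
    have h2 : ε * c₀ / 4 * (x : ℝ) / Real.log x ^ 2 = ε / 4 * K := by rw [hK]; ring
    rw [← h2]
    exact h1.trans hOx
  -- (5) combine
  have hVP0 : 0 ≤ V * P := mul_nonneg hVI.1 hP0
  have hstep : (a - ε / 4) * (V * P) - R ≤
      P * V * (2 * G * Real.log (4 - 8 * δ - 1) / (4 - 8 * δ) - C₁ * Real.log y ^ (-(1 / 3 : ℝ))) - R := by
    have := mul_le_mul_of_nonneg_right hfE hVP0
    nlinarith
  have hεK : ε * K ≤ ε * (L * V) := mul_le_mul_of_nonneg_left hKM hε.le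
  have hεLV : 0 ≤ ε * (L * V) := mul_nonneg hε.le (mul_nonneg hL0 hVI.1)
  have s1 : a + R ≤ ε / 2 * K := by linarith [hRle, hCle, hj5', hj6', hj1']
  have hK0 : 0 ≤ K := by rw [hK]; positivity
  rw [hmainTerm]
  linarith [hI, hmain, s1, hREle, hεK, hstep]

end Summit.Parity.GeneralizedHardyLittlewood.Theorems
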